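import Summits.BirchSwinnertonDyer.BirchSwinnertonDyer.Theorems.GenusKolyvaginAtTwoPowDvdShaCardAtTwoRTTransverseIsotropic
import HarnessLib

/-!
# Route `GenusKolyvaginAtTwo`, crux L_T `PowDvdShaCardAtTwoRT` (stmt-BirchSwinnertonDyer-23242) / L⁺_T (stmt-23379), LINE 18/19 stub 3a⁗,
# step (b) input I7 at a REGULAR Frobenius: a regular involution inverts `μ_q`, so `hFμ` is automatic

Seat `bsd-line-gk2-p3` g19 (cell `bsd-f1-sign2`), `--supports 23242 --as helper`. THEOREMS ONLY. BSD is not proved by any of this.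

`…RTTransverseIsotropic.cupProduct_localization_eq_zero_of_transverse` takes a Frobenius `F` with the REGULAR structure on `T = E[q]`
(`F² = 1`, `T = ℤP ⊕ ℤFP` free over `ℤ/q`) AND `hFμ : F ζ = ζ⁻¹` on `μ_q`. This file derives `hFμ` from the regular structure and the
Weil pairing datum (`e` biadditive, alternating, right-non-degenerate, `Γ`-equivariant): `ζ₀ = e(P, FP)` is a PRIMITIVE `q`-th root
of unity (freeness + non-degeneracy) and `F ζ₀ = e(FP, P) = ζ₀⁻¹` (equivariance + skewness), hence `F ζ = ζ⁻¹` for every `ζ ∈ μ_q`.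
So I7 applies at LINE 19's REGULAR Kolyvagin primes (`RegularKolyvaginSupplyAtTwo`: `Frob = c₀ρ` with `2^n(P + Frob P) ≠ 0`; the
basis from `…PosTRegularEigenCyclic.free_of_regular`) with no further input: `cupProduct_localization_eq_zero_of_transverse_of_regular`.
(On `Δ < 0` with `F = c₀` this is Gross (3.3), tree `smul_eq_inv_of_smul_torsion_pow_eq`; the LEAD's `weilPairing_conj_conj_eq_inv`
is the converse direction.)

References: [GrossLMS1991] §3 (3.1)–(3.3); [McCallumLMS1991] §5 Lemma 5.3; [SilvermanAEC2009] III.8.1.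
-/

set_option autoImplicit false
set_option linter.dupNamespace false -- tree convention: `Summit.BirchSwinnertonDyer.BirchSwinnertonDyer.Theorems` (summit = sub-problem)

noncomputable section
open scoped Classical Pointwise
universe u

namespace Summit.BirchSwinnertonDyer.BirchSwinnertonDyer.Theorems.GenusExact.TransverseIsotropy

open WeierstrassCurve NumberField IsDedekindDomain Field
open Literature.NumberTheory.EllipticCurves Literature.NumberTheory.GaloisRepresentations
open Literature.NumberTheory.GaloisCohomology

section Pairing

variable {K : Type u} [Field K] (W : WeierstrassCurve K) {q : ℕ} [NeZero q]
  (e : geomTorsion W q → geomTorsion W q → AlgebraicClosure K)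
  (hμ : ∀ S T, e S T ^ q = 1) (hadd₁ : ∀ S₁ S₂ T, e (S₁ + S₂) T = e S₁ T * e S₂ T)
  (hadd₂ : ∀ S T₁ T₂, e S (T₁ + T₂) = e S T₁ * e S T₂) (halt : ∀ T, e T T = 1)

include hμ in
/-- Values of a `μ_q`-valued pairing are non-zero (`q ≥ 1`). [folklore] -/
theorem pairing_ne_zero (S T : geomTorsion W q) : e S T ≠ 0 := fun h ↦ by
  have := hμ S T
  rw [h, zero_pow (NeZero.ne q)] at this
  exact zero_ne_one this

include hμ hadd₁ in
/-- `e 0 T = 1` for a biadditive `μ_q`-valued pairing. [folklore] -/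
theorem pairing_zero_left (T : geomTorsion W q) : e 0 T = 1 := by
  have h := hadd₁ 0 0 T
  rw [add_zero] at h
  exact (mul_eq_left₀ (pairing_ne_zero W e hμ 0 T)).mp h.symm

include hμ hadd₁ in
/-- `e (k • S) T = (e S T)^k`. [folklore] -/
theorem pairing_nsmul_left (k : ℕ) (S T : geomTorsion W q) : e (k • S) T = e S T ^ k := by
  induction k with
  | zero => rw [zero_smul, pow_zero, pairing_zero_left W e hμ hadd₁]
  | succ k ih => rw [succ_nsmul, hadd₁, ih, pow_succ]

/-- `weilPairingHom S T = 0 ↔ e S T = 1` (the additive reading). [folklore] -/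
theorem weilPairingHom_eq_zero_iff_eq_one (S T : geomTorsion W q) :
    weilPairingHom W q e hμ hadd₁ hadd₂ S T = 0 ↔ e S T = 1 := by
  rw [muCarrier_eq_iff, coe_weilPairingHom]
  rfl

omit [NeZero q] in
include hadd₁ hadd₂ halt in
/-- **Skewness from alternation**: `e T S = (e S T)⁻¹`. [folklore] -/
theorem pairing_swap_eq_inv (S T : geomTorsion W q) : e T S = (e S T)⁻¹ := by
  have h := halt (S + T)
  rw [hadd₁, hadd₂, hadd₂, halt, halt, one_mul, mul_one] at h
  exact eq_inv_of_mul_eq_one_right h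

end Pairing

section Regular

variable {K : Type u} [Field K] (W : WeierstrassCurve K) {q : ℕ} [NeZero q]
  (e : geomTorsion W q → geomTorsion W q → AlgebraicClosure K)
  (hμ : ∀ S T, e S T ^ q = 1) (hadd₁ : ∀ S₁ S₂ T, e (S₁ + S₂) T = e S₁ T * e S₂ T)
  (hadd₂ : ∀ S T₁ T₂, e S (T₁ + T₂) = e S T₁ * e S T₂) (halt : ∀ T, e T T = 1)
  (hnondeg : ∀ T, (∀ S, e S T = 1) → T = 0)
  (hgal : ∀ (σ : absoluteGaloisGroup K) (S T : geomTorsion W q), σ • e S T = e (σ • S) (σ • T))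

include hμ hadd₁ hadd₂ halt hnondeg in
/-- **`e(P, FP)` is a primitive `q`-th root of unity** when `T = ℤP ⊕ ℤFP` is free over `ℤ/q`: if `e(P,FP)^k = 1` then `kP` pairs
trivially with `P` and `FP`, hence with everything, so `kP = 0` and `q ∣ k`. [cite: GrossLMS1991, §3 (3.3)] -/
theorem isPrimitiveRoot_pairing_of_regular {F : absoluteGaloisGroup K} {P : geomTorsion W q}
    (hgen : ∀ Q : geomTorsion W q, ∃ x y : ℤ, Q = x • P + y • F • P)
    (hfree : ∀ x y : ℤ, x • P + y • F • P = 0 → (q : ℤ) ∣ x ∧ (q : ℤ) ∣ y) :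
    IsPrimitiveRoot (e P (F • P)) q := by
  have hq : 0 < q := Nat.pos_of_ne_zero (NeZero.ne q)
  set B := weilPairingHom W q e hμ hadd₁ hadd₂ with hB
  have hB0 : ∀ S T, B S T = 0 ↔ e S T = 1 := weilPairingHom_eq_zero_iff_eq_one W e hμ hadd₁ hadd₂
  refine IsPrimitiveRoot.mk_of_lt (e P (F • P)) hq (hμ P (F • P)) fun k hk0 hkq hk ↦ ?_
  have h1 : e (k • P) (F • P) = 1 := by rw [pairing_nsmul_left W e hμ hadd₁, hk]
  have h2 : e (k • P) P = 1 := by rw [pairing_nsmul_left W e hμ hadd₁, halt, one_pow]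
  have hP0 : B P (k • P) = 0 :=
    (hB0 _ _).mpr (by rw [pairing_swap_eq_inv W e hadd₁ hadd₂ halt (k • P) P, h2, inv_one])
  have hFP0 : B (F • P) (k • P) = 0 :=
    (hB0 _ _).mpr (by rw [pairing_swap_eq_inv W e hadd₁ hadd₂ halt (k • P) (F • P), h1, inv_one])
  have h3 : ∀ S, e S (k • P) = 1 := by
    intro S
    obtain ⟨x, y, rfl⟩ := hgen S
    apply (hB0 _ _).mp
    rw [← AddMonoidHom.flip_apply B, map_add, map_zsmul, map_zsmul, AddMonoidHom.flip_apply, AddMonoidHom.flip_apply,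
      hP0, hFP0, smul_zero, smul_zero, add_zero]
  have h4 : k • P = 0 := hnondeg _ h3
  have h5 : (q : ℤ) ∣ (k : ℤ) :=
    (hfree k 0 (by rw [zero_smul, add_zero, natCast_zsmul, h4])).1
  exact absurd (Nat.le_of_dvd hk0 (Int.natCast_dvd_natCast.mp h5)) (not_le.mpr hkq)

include hμ hadd₁ hadd₂ halt hnondeg hgal in
/-- **A regular involution inverts `μ_q`.** If `F ∈ Γ_K` acts on `T = E[q]` with `F² = 1` and `T = ℤP ⊕ ℤFP` free over `ℤ/q`
(a REGULAR involution: complex conjugation on `Δ < 0`, or LINE 19's regular Kolyvagin Frobenius), then `F ζ = ζ⁻¹` for every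
`q`-th root of unity `ζ`: `F e(P,FP) = e(FP, P) = e(P,FP)⁻¹` and `e(P,FP)` generates `μ_q`. (Converse of Gross (3.3) for `c₀`;
supplies the hypothesis `hFμ` of `cupProduct_localization_eq_zero_of_transverse`.) [cite: GrossLMS1991, §3 (3.3)] -/
theorem smul_eq_inv_of_regular {F : absoluteGaloisGroup K} {P : geomTorsion W q} (hF : ∀ Q : geomTorsion W q, F • F • Q = Q)
    (hgen : ∀ Q : geomTorsion W q, ∃ x y : ℤ, Q = x • P + y • F • P)
    (hfree : ∀ x y : ℤ, x • P + y • F • P = 0 → (q : ℤ) ∣ x ∧ (q : ℤ) ∣ y)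
    {ζ : AlgebraicClosure K} (hζ : ζ ^ q = 1) : F • ζ = ζ⁻¹ := by
  have hprim := isPrimitiveRoot_pairing_of_regular W e hμ hadd₁ hadd₂ halt hnondeg hgen hfree
  obtain ⟨i, -, rfl⟩ := hprim.eq_pow_of_pow_eq_one hζ
  have h0 : F • e P (F • P) = (e P (F • P))⁻¹ := by
    rw [hgal, hF, pairing_swap_eq_inv W e hadd₁ hadd₂ halt P (F • P)]
  change absoluteGaloisGroup.toAlgEquiv K F (e P (F • P) ^ i) = _
  rw [map_pow]
  change (F • e P (F • P)) ^ i = _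
  rw [h0, inv_pow]

end Regular

section Rat

variable {v : HeightOneSpectrum (𝓞 ℚ)} (W : WeierstrassCurve ℚ) [W.IsElliptic]

/-- **I7 at a REGULAR Frobenius, no `μ`-hypothesis** (LINE 19's regular Kolyvagin primes; also LINE 18): the setting of
`cupProduct_localization_eq_zero_of_transverse` with `hFμ` replaced by right-non-degeneracy of `e` — two classes transverse at `v` have
vanishing local Weil cup product. [cite: McCallumLMS1991, §5 Lemma 5.3] [cite: GrossLMS1991, §3 (3.3)] -/
theorem cupProduct_localization_eq_zero_of_transverse_of_regular {p M q : ℕ} [NeZero q] (hp : p.Prime) (hq : q = p ^ M)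
    (hqv : (q : 𝓞 ℚ) ∉ v.asIdeal)
    {𝔐 : Ideal (HeightOneSpectrum.localAbsIntegers v)} (h𝔐 : 𝔐 ∈ v.localPrimesAbove)
    {F : absoluteGaloisGroup ℚ}
    (hFrob : IsArithFrobAt (𝓞 ℚ) F (v.primeBelow (closureEmb (K := ℚ) (v.adicCompletion ℚ)) 𝔐))
    (hF : ∀ Q : geomTorsion W (q : ℤ), F • F • Q = Q)
    {P : geomTorsion W (q : ℤ)} (hPq : (q : ℤ) • P = 0)
    (hgen : ∀ Q : geomTorsion W (q : ℤ), ∃ x y : ℤ, Q = x • P + y • F • P)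
    (hfree : ∀ x y : ℤ, x • P + y • F • P = 0 → (q : ℤ) ∣ x ∧ (q : ℤ) ∣ y)
    (hI : (v.primeBelow (closureEmb (K := ℚ) (v.adicCompletion ℚ)) 𝔐).inertia (absoluteGaloisGroup ℚ) ≤
      torsionFixing W (q : ℤ))
    (hopen : IsOpen (torsionFixing W (q : ℤ) : Set (absoluteGaloisGroup ℚ)))
    (e : geomTorsion W q → geomTorsion W q → AlgebraicClosure ℚ)
    (hμ : ∀ S T, e S T ^ q = 1) (hadd₁ : ∀ S₁ S₂ T, e (S₁ + S₂) T = e S₁ T * e S₂ T)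
    (hadd₂ : ∀ S T₁ T₂, e S (T₁ + T₂) = e S T₁ * e S T₂) (halt : ∀ T, e T T = 1)
    (hnondeg : ∀ T, (∀ S, e S T = 1) → T = 0)
    (hgal : ∀ (σ : absoluteGaloisGroup ℚ) (S T : geomTorsion W q), σ • e S T = e (σ • S) (σ • T))
    {x y : galH1Torsion W (q : ℤ)}
    (hx : ∃ P₁ : geomTorsion W (q : ℤ), h1Eval W (q : ℤ) x F = F • P₁ - P₁)
    (hy : ∃ P₂ : geomTorsion W (q : ℤ), h1Eval W (q : ℤ) y F = F • P₂ - P₂) :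
    haveI := absoluteGaloisGroup_compactSpace (v.adicCompletion ℚ)
    ((weilContPairing W q e hμ hadd₁ hadd₂ hgal).restrict
      (absGaloisRestrict ℚ (v.adicCompletion ℚ))).cupProduct
        (galoisCohomology.localization (W.torsionGaloisModule ((q : ℕ) : ℤ)) (Sum.inr v) 1 x)
        (galoisCohomology.localization (W.torsionGaloisModule ((q : ℕ) : ℤ)) (Sum.inr v) 1 y) = 0 :=
  cupProduct_localization_eq_zero_of_transverse W hp hq hqv h𝔐 hFrob
    (fun _ hζ ↦ smul_eq_inv_of_regular W e hμ hadd₁ hadd₂ halt hnondeg hgal hF hgen hfree hζ)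
    hF hPq hgen hfree hI hopen e hμ hadd₁ hadd₂ halt hgal hx hy

end Rat

end Summit.BirchSwinnertonDyer.BirchSwinnertonDyer.Theorems.GenusExact.TransverseIsotropy

end
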